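import Mathlib.Analysis.MellinInversion
import Mathlib.NumberTheory.LSeries.Dirichlet
import Mathlib.Analysis.SpecialFunctions.ImproperIntegrals
import Mathlib.Analysis.SpecialFunctions.JapaneseBracket
import Literature.NumberTheory.LFunctions.MertensBoundRH
import HarnessLib

/-!
# Riesz means of `μ(a) a^{-w}` approximate `1/ζ(w)` on `Re w > 1/2` under RH (Perron's formula)

Topic: `Literature/NumberTheory/LFunctions`. Under the Riemann hypothesis, for `0 < δ < 1/2` and
`0 < ε ≤ 1/2`, the second-order Riesz means of the Dirichlet series `1/ζ(w) = Σ μ(a) a^{-w}` satisfy,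
uniformly on the line `Re w = 1/2 + δ`,

  `|Σ_{a ≤ n} μ(a) (1 - a/n)² a^{-w} - 1/ζ(w)| ≤ C n^{-δ/2} (1 + |Im w|)^ε`
  (`Literature.NumberTheory.LFunctions.RieszPerron.norm_rieszSum_sub_inv_riemannZeta_le`).

This is a smoothed form of Littlewood's theorem "RH ⇒ `Σ μ(a)a^{-s}` converges to `1/ζ(s)` for
`Re s > 1/2`" (Titchmarsh, *The Theory of the Riemann Zeta-Function*, 2nd ed. (1986), Thm. 14.25
(A)) with the uniformity in `Im w` of Balazard–Saias (*Notes sur la fonction ζ de Riemann, 1*,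
Adv. Math. 139 (1998), Lemme 2, quoted as Lemma 2.1 of Báez-Duarte 2003), which is the input of
the deep half of the Nyman–Beurling–Báez-Duarte criterion; the Riesz weights `(1 - a/n)²` make
every integral absolutely convergent. The argument is the printed one (Titchmarsh §14.25, proof of
Thm. 14.25 (C): Perron's formula and a shift of the line of integration to `Re = 1/2 + δ`, allowed
by RH, with Littlewood's bound (14.2.6) on the new line):

* The kernel `k(u) = (1-u)₊²` has Mellin transform `K(z) = 1/z - 2/(z+1) + 1/(z+2) =
  2/(z(z+1)(z+2))` for `Re z > 0` (`hasMellin_kfun`), and `k - 1` has the same Mellin transform on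
  `-1 < Re z < 0` (`hasMellin_kfun_sub_one`); Mellin inversion (Mathlib `mellinInv_mellin_eq`)
  gives `k(x) = (1/2π) ∫ x^{-z} K(z) dy` on `Re z = c > 0` (`kfun_eq_integral`) and the two
  evaluations `∫ K(c+iy) dy = 0`, `∫ K(-η+iy) dy = -2π` (`integral_Kfun_line_pos/neg`; the
  residue `1` of `K` at `0`).
* Perron's formula for the Riesz means (`rieszSum_eq_integral`): inserting the inversion formula
  and summing the absolutely convergent series `Σ μ(a) a^{-w-z} = 1/ζ(w+z)` (Mathlib
  `LSeries_one_mul_Lseries_moebius`) under the integral,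
  `Σ_{a≤n} μ(a)(1-a/n)² a^{-w} = (1/2π) ∫ n^{c+iy} K(c+iy) ζ(w+c+iy)⁻¹ dy` for `Re w + c > 1`.
* The shift past the pole of `K` at `z = 0` under RH (`perronIntegral_shift`): Cauchy's theorem
  (`Literature.NumberTheory.LFunctions.MertensBoundRH.integral_vertical_eq_of_tendsto`) for the pole-free function
  `(2/((z+1)(z+2))) (f(z) - f(0))/z`, `f(z) = n^z ζinv(w+z)`, where `ζinv` is `1/ζ` with the
  removable singularity at `1` filled in (`Literature.NumberTheory.LFunctions.MertensBoundRH.zetaInv`, holomorphic on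
  `Re s > 1/2` under RH), plus the two kernel integrals above:
  `∫_{Re z = c} n^z K ζinv(w+z) = 2π ζinv(w) + ∫_{Re z = -η} n^z K ζinv(w+z)`.
* On `Re z = -δ/2`: `|n^z| = n^{-δ/2}`, `|ζinv(w+z)| ≤ K_z (1+|t+y|)^ε` (Littlewood, Titchmarsh
  (14.2.6), in the uniform form `Literature.NumberTheory.LFunctions.MertensBoundRH.exists_bound_zetaInv`), and
  `∫ |K(-δ/2+iy)| (1+|y|)^ε dy < ∞`.

## References

* E. C. Titchmarsh, *The Theory of the Riemann Zeta-Function*, 2nd ed. revised by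
  D. R. Heath-Brown, Oxford 1986: §3.12 (Perron's formula), Thm. 14.25 (A), (C) and §14.25,
  Thm. 14.2 (14.2.6).
* M. Balazard, E. Saias, *Notes sur la fonction ζ de Riemann, 1*, Adv. Math. 139 (1998), 310–321,
  Lemme 2.
* L. Báez-Duarte, *A strengthening of the Nyman–Beurling criterion for the Riemann hypothesis*,
  Rend. Lincei (9) Mat. Appl. 14 (2003), 5–11, Lemma 2.1 and §2.2.
* H. L. Montgomery, R. C. Vaughan, *Multiplicative Number Theory I* (2007), §5.1 (Riesz means via
  Mellin inversion).

The file has no definitions (the kernel `k`, its transform `K` and the Riesz sums are written out).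
-/

noncomputable section

open Complex Filter Topology Set MeasureTheory Asymptotics
open scoped Real

namespace Literature.NumberTheory.LFunctions

namespace RieszPerron

/-! ### The Riesz kernel `k(u) = (1-u)₊²` and its Mellin transform `K(z) = 2/(z(z+1)(z+2))` -/

/-- `K(z) = 2/(z(z+1)(z+2))` off the poles. [folklore] -/
lemma Kfun_eq {z : ℂ} (h0 : z ≠ 0) (h1 : z + 1 ≠ 0) (h2 : z + 2 ≠ 0) :
    ((1 : ℂ) / z - 2 / (z + 1) + 1 / (z + 2)) = 2 / (z * (z + 1) * (z + 2)) := by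
  field_simp
  ring

/-- `k` is continuous. [folklore] -/
lemma continuous_kfun : Continuous fun t : ℝ ↦ ((((max (1 - t) 0) ^ 2 : ℝ)) : ℂ) := by
  refine continuous_ofReal.comp ?_
  exact ((continuous_const.sub continuous_id).max continuous_const).pow 2

/-- On `(0, ∞)`, `k` agrees with the indicator combination `𝟙_{(0,1]}(t)(1 - 2t + t²)`. [folklore] -/
lemma kfun_eqOn : EqOn (fun t : ℝ ↦ ((((max (1 - t) 0) ^ 2 : ℝ)) : ℂ)) (fun t : ℝ ↦ indicator (Ioc 0 1) (fun _ ↦ (1 : ℂ)) t -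
      (2 : ℂ) • indicator (Ioc 0 1) (fun t : ℝ ↦ (t : ℂ) ^ (1 : ℂ)) t +
      indicator (Ioc 0 1) (fun t : ℝ ↦ (t : ℂ) ^ (2 : ℂ)) t) (Ioi 0) := by
  intro t ht
  have ht0 : 0 < t := ht
  simp only
  rcases le_or_gt t 1 with h1 | h1
  · have hmem : t ∈ Ioc (0 : ℝ) 1 := ⟨ht0, h1⟩
    simp only [indicator_of_mem hmem, cpow_one, smul_eq_mul]
    rw [max_eq_left (by linarith), show ((t : ℂ) ^ (2 : ℂ)) = (t : ℂ) ^ (2 : ℕ) from by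
      exact_mod_cast cpow_natCast (t : ℂ) 2]
    push_cast
    ring
  · have hnmem : t ∉ Ioc (0 : ℝ) 1 := fun h ↦ absurd h.2 (not_le.mpr h1)
    simp only [indicator_of_notMem hnmem, smul_zero, sub_zero, add_zero]
    rw [max_eq_right (by linarith)]
    simp

/-- **Mellin transform of the Riesz kernel:** for `Re z > 0`, `k` is Mellin-convergent at `z` and
`(Mk)(z) = 1/z - 2/(z+1) + 1/(z+2)` (Euler's Beta integral `B(z,3)`). [folklore] -/
theorem hasMellin_kfun {z : ℂ} (hz : 0 < z.re) : HasMellin (fun t : ℝ ↦ ((((max (1 - t) 0) ^ 2 : ℝ)) : ℂ)) z (((1 : ℂ) / z - 2 / (z + 1) + 1 / (z + 2))) := by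
  have h0 := hasMellin_one_Ioc hz
  have h1 := hasMellin_cpow_Ioc 1 (s := z) (by simp; linarith)
  have h2 := hasMellin_cpow_Ioc 2 (s := z) (by simp; linarith)
  have h1' := hasMellin_const_smul h1.1 (2 : ℂ)
  have hsub := hasMellin_sub h0.1 h1'.1
  have hadd := hasMellin_add hsub.1 h2.1
  rw [hsub.2, h1'.2, h0.2, h1.2, h2.2] at hadd
  -- transfer along the a.e. equality on `Ioi 0`
  have hcongr : MellinConvergent (fun t : ℝ ↦ ((((max (1 - t) 0) ^ 2 : ℝ)) : ℂ)) z ↔ MellinConvergent (fun t : ℝ ↦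
      indicator (Ioc 0 1) (fun _ ↦ (1 : ℂ)) t -
      (2 : ℂ) • indicator (Ioc 0 1) (fun t : ℝ ↦ (t : ℂ) ^ (1 : ℂ)) t +
      indicator (Ioc 0 1) (fun t : ℝ ↦ (t : ℂ) ^ (2 : ℂ)) t) z := by
    refine integrableOn_congr_fun (fun t ht ↦ ?_) measurableSet_Ioi
    simp only [kfun_eqOn ht]
  have hval : mellin (fun t : ℝ ↦ ((((max (1 - t) 0) ^ 2 : ℝ)) : ℂ)) z = mellin (fun t : ℝ ↦
      indicator (Ioc 0 1) (fun _ ↦ (1 : ℂ)) t -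
      (2 : ℂ) • indicator (Ioc 0 1) (fun t : ℝ ↦ (t : ℂ) ^ (1 : ℂ)) t +
      indicator (Ioc 0 1) (fun t : ℝ ↦ (t : ℂ) ^ (2 : ℂ)) t) z := by
    refine setIntegral_congr_fun measurableSet_Ioi (fun t ht ↦ ?_)
    simp only [kfun_eqOn ht]
  refine ⟨hcongr.mpr hadd.1, ?_⟩
  rw [hval, hadd.2]
  simp only [smul_eq_mul, one_div]
  ring

/-! ### Bounds for the kernel on vertical lines -/

/-- On the vertical line `Re z = σ`, at distance `≥ m > 0` from the poles `0, -1, -2`: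
`‖K(σ+iy)‖ ≤ 2/(m(m²+y²))`. [folklore] -/
lemma norm_Kfun_le {σ m : ℝ} (hm : 0 < m) (h0 : m ≤ |σ|) (h1 : m ≤ |σ + 1|) (h2 : m ≤ |σ + 2|)
    (y : ℝ) : ‖((1 : ℂ) / (σ + y * I) - 2 / ((σ + y * I) + 1) + 1 / ((σ + y * I) + 2))‖ ≤ 2 / (m * (m ^ 2 + y ^ 2)) := by
  set z : ℂ := σ + y * I with hz
  have hsq : ∀ j : ℝ, ‖z + j‖ ^ 2 = (σ + j) ^ 2 + y ^ 2 := by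
    intro j
    rw [Complex.sq_norm, Complex.normSq_apply, hz]; simp; ring
  set r : ℝ := Real.sqrt (m ^ 2 + y ^ 2) with hr
  have hr0 : 0 < r := Real.sqrt_pos.mpr (by positivity)
  have hrm : m ≤ r := by
    rw [hr, Real.le_sqrt' hm]; nlinarith
  have hr2 : r ^ 2 = m ^ 2 + y ^ 2 := Real.sq_sqrt (by positivity)
  have hge : ∀ j : ℝ, m ≤ |σ + j| → r ≤ ‖z + j‖ := by
    intro j hj
    refine (pow_le_pow_iff_left₀ hr0.le (norm_nonneg _) two_ne_zero).mp ?_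
    rw [hr2, hsq]
    have : m ^ 2 ≤ (σ + j) ^ 2 := by
      rw [← sq_abs (σ + j)]; exact pow_le_pow_left₀ hm.le hj 2
    linarith
  have hz0 : r ≤ ‖z‖ := by simpa using hge 0 (by simpa using h0)
  have hz1 : r ≤ ‖z + 1‖ := by exact_mod_cast hge 1 (by exact_mod_cast h1)
  have hz2 : r ≤ ‖z + 2‖ := by exact_mod_cast hge 2 (by exact_mod_cast h2)
  have hne0 : z ≠ 0 := norm_pos_iff.mp (hr0.trans_le hz0)
  have hne1 : z + 1 ≠ 0 := norm_pos_iff.mp (hr0.trans_le hz1)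
  have hne2 : z + 2 ≠ 0 := norm_pos_iff.mp (hr0.trans_le hz2)
  rw [Kfun_eq hne0 hne1 hne2, norm_div, Complex.norm_ofNat, norm_mul, norm_mul]
  rw [div_le_div_iff₀ (by positivity) (by positivity)]
  have h3 : m * (m ^ 2 + y ^ 2) ≤ ‖z‖ * ‖z + 1‖ * ‖z + 2‖ := by
    calc m * (m ^ 2 + y ^ 2) = m * r * r := by rw [← hr2]; ring
      _ ≤ ‖z‖ * ‖z + 1‖ * ‖z + 2‖ := by
          have := mul_le_mul hz0 hz1 hr0.le (norm_nonneg _)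
          have h' : m * r ≤ ‖z‖ * ‖z + 1‖ := by nlinarith
          exact mul_le_mul h' hz2 hr0.le (by positivity)
  linarith

/-- `y ↦ 1/(m² + y²)` is integrable on `ℝ` for `m ≠ 0`. [folklore] -/
lemma integrable_inv_sq_add_sq {m : ℝ} (hm : m ≠ 0) :
    Integrable fun y : ℝ ↦ (m ^ 2 + y ^ 2)⁻¹ := by
  have h := (integrable_inv_one_add_sq.comp_div hm).const_mul (m ^ 2)⁻¹
  refine h.congr (Eventually.of_forall fun y ↦ ?_)
  simp only []
  have hm2 : m ^ 2 ≠ 0 := pow_ne_zero 2 hm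
  field_simp

/-- `y ↦ (1+|y|)^ε / (m² + y²)` is integrable on `ℝ` for `m ≠ 0`, `ε < 1`. [folklore] -/
lemma integrable_rpow_div_sq_add_sq {m ε : ℝ} (hm : m ≠ 0) (hε : ε < 1) :
    Integrable fun y : ℝ ↦ (1 + |y|) ^ ε / (m ^ 2 + y ^ 2) := by
  have hr : (Module.finrank ℝ ℝ : ℝ) < 2 - ε := by simp; linarith
  have h := (integrable_one_add_norm (E := ℝ) (μ := volume) hr).const_mul (2 * max 1 (m ^ 2)⁻¹)
  refine h.mono' ?_ (Eventually.of_forall fun y ↦ ?_)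
  · refine Continuous.aestronglyMeasurable ?_
    refine Continuous.div ?_ (by fun_prop) (fun y ↦ by positivity)
    exact (continuous_const.add continuous_abs).rpow_const fun y ↦ Or.inl (by
      show (1 : ℝ) + |y| ≠ 0
      positivity)
  · have hy : 0 ≤ |y| := abs_nonneg y
    have hm2 : 0 < m ^ 2 := by positivity
    have hpos : 0 < m ^ 2 + y ^ 2 := by positivity
    rw [Real.norm_eq_abs, abs_of_nonneg (by positivity), Real.norm_eq_abs]
    -- `(1+|y|)² ≤ 2 max(1, m⁻²) (m² + y²)`
    have hkey : (1 + |y|) ^ 2 ≤ 2 * max 1 (m ^ 2)⁻¹ * (m ^ 2 + y ^ 2) := by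
      have h1 : (1 + |y|) ^ 2 ≤ 2 * (1 + y ^ 2) := by nlinarith [sq_abs y, sq_nonneg (|y| - 1)]
      have h2 : (1 : ℝ) ≤ max 1 (m ^ 2)⁻¹ * m ^ 2 := by
        have := le_max_right 1 (m ^ 2)⁻¹
        calc (1 : ℝ) = (m ^ 2)⁻¹ * m ^ 2 := by field_simp
          _ ≤ max 1 (m ^ 2)⁻¹ * m ^ 2 := by gcongr
      have h3 : y ^ 2 ≤ max 1 (m ^ 2)⁻¹ * y ^ 2 := by
        have := le_max_left 1 (m ^ 2)⁻¹
        nlinarith [sq_nonneg y]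
      nlinarith
    have hsplit : (1 + |y|) ^ ε = (1 + |y|) ^ (2 : ℝ) * (1 + |y|) ^ (-(2 - ε)) := by
      rw [← Real.rpow_add (by positivity)]; ring_nf
    rw [hsplit, div_le_iff₀ hpos]
    have h4 : 0 ≤ (1 + |y|) ^ (-(2 - ε)) := Real.rpow_nonneg (by positivity) _
    calc (1 + |y|) ^ (2 : ℝ) * (1 + |y|) ^ (-(2 - ε))
        = (1 + |y|) ^ 2 * (1 + |y|) ^ (-(2 - ε)) := by norm_cast
      _ ≤ (2 * max 1 (m ^ 2)⁻¹ * (m ^ 2 + y ^ 2)) * (1 + |y|) ^ (-(2 - ε)) := by gcongr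
      _ = 2 * max 1 (m ^ 2)⁻¹ * (1 + |y|) ^ (-(2 - ε)) * (m ^ 2 + y ^ 2) := by ring

/-- `y ↦ K(σ+iy)` is continuous when the line avoids the poles. [folklore] -/
lemma continuous_Kfun_line {σ : ℝ} (h0 : σ ≠ 0) (h1 : σ + 1 ≠ 0) (h2 : σ + 2 ≠ 0) :
    Continuous fun y : ℝ ↦ ((1 : ℂ) / (σ + y * I) - 2 / ((σ + y * I) + 1) + 1 / ((σ + y * I) + 2)) := by
  have hne : ∀ (j : ℝ), σ + j ≠ 0 → ∀ y : ℝ, (σ : ℂ) + y * I + j ≠ 0 := by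
    intro j hj y h
    have := congrArg re h
    simp at this
    exact hj this
  refine Continuous.add (Continuous.sub ?_ ?_) ?_
  · refine Continuous.div continuous_const (by fun_prop) fun y ↦ ?_
    simpa using hne 0 (by simpa using h0) y
  · refine Continuous.div continuous_const (by fun_prop) fun y ↦ ?_
    exact_mod_cast hne 1 (by exact_mod_cast h1) y
  · refine Continuous.div continuous_const (by fun_prop) fun y ↦ ?_
    exact_mod_cast hne 2 (by exact_mod_cast h2) y

/-- Integrability of `K` on a vertical line at distance `≥ m > 0` from the poles, with a weight
`(1+|y|)^ε`, `ε < 1`. [folklore] -/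
lemma integrable_Kfun_line_rpow {σ m ε : ℝ} (hm : 0 < m) (h0 : m ≤ |σ|) (h1 : m ≤ |σ + 1|)
    (h2 : m ≤ |σ + 2|) (hε : ε < 1) :
    Integrable fun y : ℝ ↦ ‖((1 : ℂ) / (σ + y * I) - 2 / ((σ + y * I) + 1) + 1 / ((σ + y * I) + 2))‖ * (1 + |y|) ^ ε := by
  have hσ0 : σ ≠ 0 := by intro h; rw [h] at h0; simp at h0; linarith
  have hσ1 : σ + 1 ≠ 0 := by intro h; rw [h] at h1; simp at h1; linarith
  have hσ2 : σ + 2 ≠ 0 := by intro h; rw [h] at h2; simp at h2; linarith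
  have hint := (integrable_rpow_div_sq_add_sq hm.ne' hε).const_mul (2 / m)
  refine hint.mono' ?_ (Eventually.of_forall fun y ↦ ?_)
  · refine Continuous.aestronglyMeasurable ?_
    refine ((continuous_Kfun_line hσ0 hσ1 hσ2).norm).mul ?_
    exact (continuous_const.add continuous_abs).rpow_const fun y ↦ Or.inl (by
      show (1 : ℝ) + |y| ≠ 0
      positivity)
  · have hK := norm_Kfun_le hm h0 h1 h2 y
    have hw : 0 ≤ (1 + |y|) ^ ε := Real.rpow_nonneg (by positivity) _
    rw [Real.norm_eq_abs, abs_of_nonneg (by positivity)]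
    calc ‖((1 : ℂ) / (σ + y * I) - 2 / ((σ + y * I) + 1) + 1 / ((σ + y * I) + 2))‖ * (1 + |y|) ^ ε ≤ 2 / (m * (m ^ 2 + y ^ 2)) * (1 + |y|) ^ ε := by
          gcongr
      _ = 2 / m * ((1 + |y|) ^ ε / (m ^ 2 + y ^ 2)) := by
          field_simp

/-- Integrability of `K` on a vertical line at distance `≥ m > 0` from the poles. [folklore] -/
lemma integrable_Kfun_line {σ m : ℝ} (hm : 0 < m) (h0 : m ≤ |σ|) (h1 : m ≤ |σ + 1|)
    (h2 : m ≤ |σ + 2|) : Integrable fun y : ℝ ↦ ((1 : ℂ) / (σ + y * I) - 2 / ((σ + y * I) + 1) + 1 / ((σ + y * I) + 2)) := by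
  have h := integrable_Kfun_line_rpow hm h0 h1 h2 (show (0 : ℝ) < 1 by norm_num)
  have hσ0 : σ ≠ 0 := by intro h; rw [h] at h0; simp at h0; linarith
  have hσ1 : σ + 1 ≠ 0 := by intro h; rw [h] at h1; simp at h1; linarith
  have hσ2 : σ + 2 ≠ 0 := by intro h; rw [h] at h2; simp at h2; linarith
  refine h.mono' (continuous_Kfun_line hσ0 hσ1 hσ2).aestronglyMeasurable
    (Eventually.of_forall fun y ↦ ?_)
  simp [Real.rpow_zero]

/-- The Mellin transform of `k` is integrable on every vertical line `Re z = c > 0`. [folklore] -/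
lemma verticalIntegrable_mellin_kfun {c : ℝ} (hc : 0 < c) :
    VerticalIntegrable (mellin fun t : ℝ ↦ ((((max (1 - t) 0) ^ 2 : ℝ)) : ℂ)) c := by
  have hK := integrable_Kfun_line (σ := c) (m := c) hc (by rw [abs_of_pos hc])
    (by rw [abs_of_pos (by linarith)]; linarith) (by rw [abs_of_pos (by linarith)]; linarith)
  refine hK.congr (Eventually.of_forall fun y ↦ ?_)
  exact ((hasMellin_kfun (z := c + y * I) (by simpa using hc)).2).symm

/-- **Mellin inversion for the Riesz kernel:** for `c > 0` and `x > 0`,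
`k(x) = (1/2π) ∫ x^{-(c+iy)} K(c+iy) dy`. [folklore] -/
theorem kfun_eq_integral {c : ℝ} (hc : 0 < c) {x : ℝ} (hx : 0 < x) :
    ((((max (1 - x) 0) ^ 2 : ℝ)) : ℂ) = ((1 / (2 * π) : ℝ) : ℂ) *
      ∫ y : ℝ, (x : ℂ) ^ (-((c : ℂ) + y * I)) * ((1 : ℂ) / (c + y * I) - 2 / ((c + y * I) + 1) + 1 / ((c + y * I) + 2)) := by
  have hconv : MellinConvergent (fun t : ℝ ↦ ((((max (1 - t) 0) ^ 2 : ℝ)) : ℂ)) c :=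
    (hasMellin_kfun (z := c) (by simpa using hc)).1
  have h := mellinInv_mellin_eq c (fun t : ℝ ↦ ((((max (1 - t) 0) ^ 2 : ℝ)) : ℂ)) hx hconv (verticalIntegrable_mellin_kfun hc)
    continuous_kfun.continuousAt
  rw [← h, mellinInv, Complex.real_smul]
  congr 1
  refine integral_congr_ae (Eventually.of_forall fun y ↦ ?_)
  simp only [smul_eq_mul]
  rw [(hasMellin_kfun (z := c + y * I) (by simpa using hc)).2]

/-! ### Perron's formula for the Riesz means of `μ(a) a^{-w}` -/

/-- `L(μ, s) = 1/ζ(s)` for `Re s > 1` (Mathlib: `L(1,s) L(μ,s) = 1`). [folklore] -/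
lemma LSeries_moebius_eq_inv {s : ℂ} (hs : 1 < s.re) :
    LSeries (fun n : ℕ ↦ ((ArithmeticFunction.moebius n : ℤ) : ℂ)) s = (riemannZeta s)⁻¹ := by
  have h := LSeries_one_mul_Lseries_moebius hs
  rw [LSeries_one_eq_riemannZeta hs] at h
  exact (inv_eq_of_mul_eq_one_right h).symm

/-- `|μ(a)| ≤ 1` in `ℂ`. [folklore] -/
lemma norm_moebius_le (a : ℕ) : ‖((ArithmeticFunction.moebius a : ℤ) : ℂ)‖ ≤ 1 := by
  rw [Complex.norm_intCast]
  exact_mod_cast ArithmeticFunction.abs_moebius_le_one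

/-- For real `x > 0`, natural `n > 0` and complex `z`: `(x/n)^{-z} = x^{-z} n^{z}`. [folklore] -/
lemma div_natCast_cpow_neg {x : ℝ} (hx : 0 < x) {n : ℕ} (hn : 0 < n) (z : ℂ) :
    (((x / n : ℝ)) : ℂ) ^ (-z) = (x : ℂ) ^ (-z) * (n : ℂ) ^ z := by
  have hn' : (0 : ℝ) < n := by exact_mod_cast hn
  rw [div_eq_mul_inv, show (((x * (n : ℝ)⁻¹ : ℝ)) : ℂ) = (x : ℂ) * (((n : ℝ)⁻¹ : ℝ) : ℂ) by push_cast; ring,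
    Complex.mul_cpow_ofReal_nonneg hx.le (inv_nonneg.mpr hn'.le)]
  congr 1
  rw [Complex.ofReal_inv, Complex.inv_cpow _ _ (by
    rw [Complex.arg_ofReal_of_nonneg hn'.le]
    exact Real.pi_ne_zero.symm), Complex.cpow_neg, inv_inv]
  norm_cast

/-- **Perron's formula for the Riesz means** (absolutely convergent form). For `c > 0`, `n ≥ 1` and
`Re w + c > 1`,
`Σ_{a ≤ n} μ(a)(1 - a/n)² a^{-w} = (1/2π) ∫_ℝ n^{c+iy} K(c+iy) ζ(w+c+iy)⁻¹ dy`,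
`K(z) = 2/(z(z+1)(z+2))`: insert `(1-a/n)₊² = (1/2π)∫ (a/n)^{-z}K(z)dy` (Mellin inversion) and sum
the absolutely convergent Dirichlet series `Σ μ(a)a^{-w-z} = 1/ζ(w+z)` under the integral.
[cite: Titchmarsh1986, §3.12 (Perron's formula; Riesz-mean variant)] -/
theorem rieszSum_eq_integral {c : ℝ} (hc : 0 < c) {w : ℂ} (hw : 1 < w.re + c) {n : ℕ}
    (hn : 0 < n) :
    ∑ a ∈ Finset.range n, ((ArithmeticFunction.moebius (a + 1) : ℤ) : ℂ) *
        ((((1 : ℝ) - ((a : ℝ) + 1) / n) ^ 2 : ℝ) : ℂ) * ((a : ℂ) + 1) ^ (-w) =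
      ((1 / (2 * π) : ℝ) : ℂ) * ∫ y : ℝ, (n : ℂ) ^ ((c : ℂ) + y * I) * ((1 : ℂ) / (c + y * I) - 2 / ((c + y * I) + 1) + 1 / ((c + y * I) + 2)) *
        (riemannZeta (w + c + y * I))⁻¹ := by
  have hn' : (0 : ℝ) < n := by exact_mod_cast hn
  -- the summands as a function on ℕ
  set T : ℕ → ℂ := fun a ↦ ((ArithmeticFunction.moebius a : ℤ) : ℂ) * (a : ℂ) ^ (-w) *
    ((((max (1 - ((a : ℝ) / n)) 0) ^ 2 : ℝ)) : ℂ) with hT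
  -- Step A: the finite sum is `∑' a, T a`
  have hT0 : T 0 = 0 := by simp [hT]
  have hTvan : ∀ a ∉ Finset.range (n + 1), T a = 0 := by
    intro a ha
    rw [Finset.mem_range, not_lt] at ha
    have : (1 : ℝ) ≤ (a : ℝ) / n := by
      rw [le_div_iff₀ hn', one_mul]; exact_mod_cast (by omega : n ≤ a)
    simp [hT, max_eq_right (by linarith : (1 : ℝ) - a / n ≤ 0)]
  have hsumT : ∑ a ∈ Finset.range n, ((ArithmeticFunction.moebius (a + 1) : ℤ) : ℂ) *
      ((((1 : ℝ) - ((a : ℝ) + 1) / n) ^ 2 : ℝ) : ℂ) * ((a : ℂ) + 1) ^ (-w) = ∑' a, T a := by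
    rw [tsum_eq_sum hTvan, Finset.sum_range_succ', hT0, add_zero]
    refine Finset.sum_congr rfl fun a ha ↦ ?_
    rw [Finset.mem_range] at ha
    have hle : ((a : ℝ) + 1) / n ≤ 1 := by
      rw [div_le_one hn']; exact_mod_cast (by omega : a + 1 ≤ n)
    simp only [hT]
    rw [max_eq_left (by push_cast; linarith)]
    push_cast
    ring
  rw [hsumT]
  -- Step B: each `T a` is an integral
  set F : ℕ → ℝ → ℂ := fun a y ↦ ((ArithmeticFunction.moebius a : ℤ) : ℂ) * (a : ℂ) ^ (-w) *
    (((1 / (2 * π) : ℝ) : ℂ) * ((((a : ℝ) / n : ℝ)) : ℂ) ^ (-((c : ℂ) + y * I)) * ((1 : ℂ) / (c + y * I) - 2 / ((c + y * I) + 1) + 1 / ((c + y * I) + 2)))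
    with hF
  have hTF : ∀ a, T a = ∫ y, F a y := by
    intro a
    rcases Nat.eq_zero_or_pos a with rfl | ha
    · simp [hT, hF]
    · have hx : (0 : ℝ) < (a : ℝ) / n := by positivity
      simp only [hT, hF]
      rw [kfun_eq_integral hc hx, ← integral_const_mul, ← integral_const_mul]
      refine integral_congr_ae (Eventually.of_forall fun y ↦ ?_)
      simp only
      ring
  -- Step C: interchange sum and integral
  have hKint := integrable_Kfun_line (σ := c) (m := c) hc (by rw [abs_of_pos hc])
    (by rw [abs_of_pos (by linarith)]; linarith) (by rw [abs_of_pos (by linarith)]; linarith)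
  have hc0 : (c : ℝ) ≠ 0 := hc.ne'
  have hc1 : c + 1 ≠ 0 := by linarith
  have hc2 : c + 2 ≠ 0 := by linarith
  have hKcont := continuous_Kfun_line hc0 hc1 hc2
  have hFmeas : ∀ a, AEStronglyMeasurable (F a) volume := by
    intro a
    refine Continuous.aestronglyMeasurable ?_
    simp only [hF]
    refine continuous_const.mul ((continuous_const.mul ?_).mul hKcont)
    rcases Nat.eq_zero_or_pos a with rfl | ha
    · -- base `0`: `0 ^ (-(c+iy))` is the constant `0` since `c ≠ 0`
      have : ∀ y : ℝ, ((((0 : ℕ) : ℝ) / n : ℝ) : ℂ) ^ (-((c : ℂ) + y * I)) = 0 := by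
        intro y
        rw [Nat.cast_zero, zero_div, ofReal_zero, zero_cpow]
        intro h
        have := congrArg re h
        simp at this
        exact hc0 this
      simp only [this]
      exact continuous_const
    · have hx : (0 : ℝ) < (a : ℝ) / n := by positivity
      refine Continuous.const_cpow (by fun_prop) (Or.inl ?_)
      exact_mod_cast hx.ne'
  -- norm bound for the summands
  have hFnorm : ∀ a (y : ℝ), ‖F a y‖ ≤
      (1 / (2 * π) * (n : ℝ) ^ c) * ((a : ℝ) ^ (-(w.re + c))) * ‖((1 : ℂ) / (c + y * I) - 2 / ((c + y * I) + 1) + 1 / ((c + y * I) + 2))‖ := by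
    intro a y
    rcases Nat.eq_zero_or_pos a with rfl | ha
    · simp [hF]
      positivity
    have ha' : (0 : ℝ) < a := by exact_mod_cast ha
    have hx : (0 : ℝ) < (a : ℝ) / n := by positivity
    simp only [hF, norm_mul]
    rw [show ((a : ℂ)) = ((a : ℝ) : ℂ) by norm_cast, Complex.norm_cpow_eq_rpow_re_of_pos ha',
      Complex.norm_cpow_eq_rpow_re_of_pos hx, Complex.norm_real, Real.norm_eq_abs,
      abs_of_pos (by positivity : (0 : ℝ) < 1 / (2 * π))]
    simp only [neg_re, add_re, ofReal_re, mul_re, I_re, mul_zero, ofReal_im, I_im, mul_one,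
      sub_self, add_zero]
    have hμ := norm_moebius_le a
    have e1 : ((a : ℝ) / n) ^ (-c) = (a : ℝ) ^ (-c) * (n : ℝ) ^ c := by
      rw [Real.div_rpow ha'.le hn'.le, Real.rpow_neg hn'.le, div_inv_eq_mul]
    have e2 : (a : ℝ) ^ (-w.re) * (a : ℝ) ^ (-c) = (a : ℝ) ^ (-(w.re + c)) := by
      rw [← Real.rpow_add ha']; ring_nf
    have hK0 : 0 ≤ ‖((1 : ℂ) / (c + y * I) - 2 / ((c + y * I) + 1) + 1 / ((c + y * I) + 2))‖ := norm_nonneg _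
    have hpos1 : 0 ≤ (a : ℝ) ^ (-w.re) := Real.rpow_nonneg ha'.le _
    calc ‖((ArithmeticFunction.moebius a : ℤ) : ℂ)‖ * (a : ℝ) ^ (-w.re) *
          (1 / (2 * π) * ((a : ℝ) / n) ^ (-c) * ‖((1 : ℂ) / (c + y * I) - 2 / ((c + y * I) + 1) + 1 / ((c + y * I) + 2))‖)
        ≤ 1 * (a : ℝ) ^ (-w.re) * (1 / (2 * π) * ((a : ℝ) / n) ^ (-c) * ‖((1 : ℂ) / (c + y * I) - 2 / ((c + y * I) + 1) + 1 / ((c + y * I) + 2))‖) := by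
          gcongr
      _ = (1 / (2 * π) * (n : ℝ) ^ c) * ((a : ℝ) ^ (-w.re) * (a : ℝ) ^ (-c)) *
          ‖((1 : ℂ) / (c + y * I) - 2 / ((c + y * I) + 1) + 1 / ((c + y * I) + 2))‖ := by rw [e1]; ring
      _ = (1 / (2 * π) * (n : ℝ) ^ c) * ((a : ℝ) ^ (-(w.re + c))) * ‖((1 : ℂ) / (c + y * I) - 2 / ((c + y * I) + 1) + 1 / ((c + y * I) + 2))‖ := by
          rw [e2]
  have hsum : Summable fun a : ℕ ↦ (a : ℝ) ^ (-(w.re + c)) :=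
    Real.summable_nat_rpow.mpr (by linarith)
  have hFint : ∑' a, ∫⁻ y, ‖F a y‖ₑ ≠ ⊤ := by
    have hle : ∀ a, ∫⁻ y, ‖F a y‖ₑ ≤
        ENNReal.ofReal ((1 / (2 * π) * (n : ℝ) ^ c) * (a : ℝ) ^ (-(w.re + c))) *
          ∫⁻ y : ℝ, ‖((1 : ℂ) / (c + y * I) - 2 / ((c + y * I) + 1) + 1 / ((c + y * I) + 2))‖ₑ := by
      intro a
      rw [← lintegral_const_mul' _ _ ENNReal.ofReal_ne_top]
      refine lintegral_mono fun y ↦ ?_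
      rw [← enorm_norm (((1 : ℂ) / (c + y * I) - 2 / ((c + y * I) + 1) + 1 / ((c + y * I) + 2))), ← enorm_norm (F a y),
        Real.enorm_eq_ofReal (norm_nonneg _), Real.enorm_eq_ofReal (norm_nonneg _),
        ← ENNReal.ofReal_mul (by positivity)]
      exact ENNReal.ofReal_le_ofReal (hFnorm a y)
    refine ne_top_of_le_ne_top ?_ (ENNReal.tsum_le_tsum hle)
    rw [ENNReal.tsum_mul_right]
    refine ENNReal.mul_ne_top ?_ hKint.2.ne
    rw [← ENNReal.ofReal_tsum_of_nonneg (fun a ↦ by positivity) (hsum.mul_left _)]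
    exact ENNReal.ofReal_ne_top
  rw [show (∑' a, T a) = ∑' a, ∫ y, F a y from tsum_congr hTF, ← integral_tsum hFmeas hFint]
  -- Step D: evaluate the inner sum
  rw [← integral_const_mul]
  refine integral_congr_ae (Eventually.of_forall fun y ↦ ?_)
  simp only
  set z : ℂ := (c : ℂ) + y * I with hz
  have hwz : 1 < (w + z).re := by simp [hz]; linarith
  have hL := LSeries_moebius_eq_inv hwz
  rw [LSeries] at hL
  have hterm : ∀ a : ℕ, F a y = ((1 / (2 * π) : ℝ) : ℂ) * ((n : ℂ) ^ z * ((1 : ℂ) / z - 2 / (z + 1) + 1 / (z + 2))) *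
      LSeries.term (fun n : ℕ ↦ ((ArithmeticFunction.moebius n : ℤ) : ℂ)) (w + z) a := by
    intro a
    rcases Nat.eq_zero_or_pos a with rfl | ha
    · simp [hF, LSeries.term_zero]
    have ha' : (0 : ℝ) < a := by exact_mod_cast ha
    have hane : (a : ℂ) ≠ 0 := by exact_mod_cast ha.ne'
    simp only [hF]
    rw [LSeries.term_of_ne_zero ha.ne', div_natCast_cpow_neg ha' hn z,
      show ((ArithmeticFunction.moebius a : ℤ) : ℂ) / (a : ℂ) ^ (w + z) =
        ((ArithmeticFunction.moebius a : ℤ) : ℂ) * ((a : ℂ) ^ (-w) * (a : ℂ) ^ (-z)) by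
        rw [← cpow_add _ _ hane, ← neg_add, cpow_neg, div_eq_mul_inv]]
    push_cast
    ring
  rw [tsum_congr hterm, tsum_mul_left, hL, hz]
  push_cast
  ring_nf

/-! ### The kernel on lines left of `Re z = 0`: `∫ K(-η+iy) dy = -2π`, `∫ K(c+iy) dy = 0` -/

/-- On `(0,∞)`, `k - 1` agrees with `𝟙_{(0,1]}(t)(t² - 2t) - 𝟙_{(1,∞)}(t)`. [folklore] -/
lemma kfun_sub_one_eqOn : EqOn (fun t : ℝ ↦ ((((max (1 - t) 0) ^ 2 : ℝ)) : ℂ) - 1) (fun t : ℝ ↦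
      indicator (Ioc 0 1) (fun t : ℝ ↦ (t : ℂ) ^ (2 : ℂ)) t -
      (2 : ℂ) • indicator (Ioc 0 1) (fun t : ℝ ↦ (t : ℂ) ^ (1 : ℂ)) t -
      indicator (Ioi 1) (fun _ ↦ (1 : ℂ)) t) (Ioi 0) := by
  intro t ht
  have ht0 : 0 < t := ht
  simp only
  rcases le_or_gt t 1 with h1 | h1
  · have hmem : t ∈ Ioc (0 : ℝ) 1 := ⟨ht0, h1⟩
    have hnmem : t ∉ Ioi (1 : ℝ) := fun h ↦ absurd h1 (not_le.mpr h)
    simp only [indicator_of_mem hmem, indicator_of_notMem hnmem, cpow_one, smul_eq_mul, sub_zero]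
    rw [max_eq_left (by linarith), show ((t : ℂ) ^ (2 : ℂ)) = (t : ℂ) ^ (2 : ℕ) from by
      exact_mod_cast cpow_natCast (t : ℂ) 2]
    push_cast
    ring
  · have hnmem : t ∉ Ioc (0 : ℝ) 1 := fun h ↦ absurd h.2 (not_le.mpr h1)
    have hmem : t ∈ Ioi (1 : ℝ) := h1
    simp only [indicator_of_notMem hnmem, indicator_of_mem hmem, smul_zero, sub_zero, zero_sub]
    rw [max_eq_right (by linarith)]
    simp

/-- The Mellin transform of `𝟙_{(1,∞)}` at `Re z < 0` is `-1/z`. [folklore] -/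
lemma hasMellin_indicator_Ioi_one {z : ℂ} (hz : z.re < 0) :
    HasMellin (indicator (Ioi 1) (fun _ ↦ (1 : ℂ))) z (-1 / z) := by
  have ha : (z - 1).re < -1 := by simp; linarith
  have hz0 : z ≠ 0 := by
    intro h; rw [h] at hz; simp at hz
  have hind : ∀ t : ℝ, (t : ℂ) ^ (z - 1) • indicator (Ioi 1) (fun _ ↦ (1 : ℂ)) t =
      indicator (Ioi 1) (fun t : ℝ ↦ (t : ℂ) ^ (z - 1)) t := by
    intro t
    by_cases ht : t ∈ Ioi (1 : ℝ)
    · simp [indicator_of_mem ht]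
    · simp [indicator_of_notMem ht]
  constructor
  · rw [MellinConvergent]
    simp_rw [hind]
    rw [integrableOn_indicator_iff measurableSet_Ioi,
      show Ioi (1 : ℝ) ∩ Ioi 0 = Ioi 1 from
        inter_eq_left.mpr (Ioi_subset_Ioi zero_le_one)]
    exact integrableOn_Ioi_cpow_of_lt ha zero_lt_one
  · rw [mellin]
    simp_rw [hind]
    rw [setIntegral_indicator measurableSet_Ioi,
      show Ioi (0 : ℝ) ∩ Ioi 1 = Ioi 1 from inter_eq_right.mpr (Ioi_subset_Ioi zero_le_one),
      integral_Ioi_cpow_of_lt ha zero_lt_one, sub_add_cancel, ofReal_one, one_cpow]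

/-- **Mellin transform of `k - 1` in the strip `-1 < Re z < 0`:** it is again
`K(z) = 1/z - 2/(z+1) + 1/(z+2)`. [folklore] -/
theorem hasMellin_kfun_sub_one {z : ℂ} (hz0 : z.re < 0) (hz1 : -1 < z.re) :
    HasMellin (fun t : ℝ ↦ ((((max (1 - t) 0) ^ 2 : ℝ)) : ℂ) - 1) z (((1 : ℂ) / z - 2 / (z + 1) + 1 / (z + 2))) := by
  have h1 := hasMellin_cpow_Ioc 1 (s := z) (by simp; linarith)
  have h2 := hasMellin_cpow_Ioc 2 (s := z) (by simp; linarith)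
  have h3 := hasMellin_indicator_Ioi_one hz0
  have h1' := hasMellin_const_smul h1.1 (2 : ℂ)
  have hsub := hasMellin_sub h2.1 h1'.1
  have hsub2 := hasMellin_sub hsub.1 h3.1
  rw [hsub.2, h1'.2, h2.2, h1.2, h3.2] at hsub2
  have hcongr : MellinConvergent (fun t : ℝ ↦ ((((max (1 - t) 0) ^ 2 : ℝ)) : ℂ) - 1) z ↔ MellinConvergent (fun t : ℝ ↦
      indicator (Ioc 0 1) (fun t : ℝ ↦ (t : ℂ) ^ (2 : ℂ)) t -
      (2 : ℂ) • indicator (Ioc 0 1) (fun t : ℝ ↦ (t : ℂ) ^ (1 : ℂ)) t -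
      indicator (Ioi 1) (fun _ ↦ (1 : ℂ)) t) z := by
    refine integrableOn_congr_fun (fun t ht ↦ ?_) measurableSet_Ioi
    simp only [kfun_sub_one_eqOn ht]
  have hval : mellin (fun t : ℝ ↦ ((((max (1 - t) 0) ^ 2 : ℝ)) : ℂ) - 1) z = mellin (fun t : ℝ ↦
      indicator (Ioc 0 1) (fun t : ℝ ↦ (t : ℂ) ^ (2 : ℂ)) t -
      (2 : ℂ) • indicator (Ioc 0 1) (fun t : ℝ ↦ (t : ℂ) ^ (1 : ℂ)) t -
      indicator (Ioi 1) (fun _ ↦ (1 : ℂ)) t) z := by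
    refine setIntegral_congr_fun measurableSet_Ioi (fun t ht ↦ ?_)
    simp only [kfun_sub_one_eqOn ht]
  refine ⟨hcongr.mpr hsub2.1, ?_⟩
  rw [hval, hsub2.2]
  simp only [smul_eq_mul, one_div]
  ring

/-- **`∫ K(-η+iy) dy = -2π`** for `0 < η < 1` (Mellin inversion for `k - 1` at `x = 1`; equivalently,
the residue `1` of `K` at `z = 0` seen from the left). [folklore] -/
theorem integral_Kfun_line_neg {η : ℝ} (hη0 : 0 < η) (hη1 : η < 1) :
    ∫ y : ℝ, ((1 : ℂ) / (((-η : ℝ) : ℂ) + y * I) - 2 / ((((-η : ℝ) : ℂ) + y * I) + 1) + 1 / ((((-η : ℝ) : ℂ) + y * I) + 2)) = -(2 * π) := by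
  set m : ℝ := min η (1 - η) with hm
  have hm0 : 0 < m := lt_min hη0 (by linarith)
  have h0 : m ≤ |(-η : ℝ)| := by rw [abs_of_neg (by linarith)]; simp [hm]
  have h1 : m ≤ |(-η : ℝ) + 1| := by
    rw [abs_of_pos (by linarith)]; exact (min_le_right _ _).trans (by linarith)
  have h2 : m ≤ |(-η : ℝ) + 2| := by
    rw [abs_of_pos (by linarith)]; exact (min_le_right _ _).trans (by linarith)
  have hK := integrable_Kfun_line hm0 h0 h1 h2
  have hconv : MellinConvergent (fun t : ℝ ↦ ((((max (1 - t) 0) ^ 2 : ℝ)) : ℂ) - 1) ((-η : ℝ) : ℂ) :=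
    (hasMellin_kfun_sub_one (z := ((-η : ℝ) : ℂ)) (by simp; linarith) (by simp; linarith)).1
  have hvert : VerticalIntegrable (mellin fun t : ℝ ↦ ((((max (1 - t) 0) ^ 2 : ℝ)) : ℂ) - 1) (-η) := by
    refine hK.congr (Eventually.of_forall fun y ↦ ?_)
    exact ((hasMellin_kfun_sub_one (z := ((-η : ℝ) : ℂ) + y * I) (by simp; linarith)
      (by simp; linarith)).2).symm
  have hcont : ContinuousAt (fun t : ℝ ↦ ((((max (1 - t) 0) ^ 2 : ℝ)) : ℂ) - 1) 1 :=
    (continuous_kfun.sub continuous_const).continuousAt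
  have h := mellinInv_mellin_eq (-η) (fun t : ℝ ↦ ((((max (1 - t) 0) ^ 2 : ℝ)) : ℂ) - 1) zero_lt_one hconv hvert hcont
  have h' : mellinInv (-η) (mellin fun t : ℝ ↦ ((((max (1 - t) 0) ^ 2 : ℝ)) : ℂ) - 1) 1 = -1 := by
    rw [h]; simp
  have e : mellinInv (-η) (mellin fun t : ℝ ↦ ((((max (1 - t) 0) ^ 2 : ℝ)) : ℂ) - 1) 1 =
      ((1 / (2 * π) : ℝ) : ℂ) * ∫ y : ℝ, ((1 : ℂ) / (((-η : ℝ) : ℂ) + y * I) - 2 / ((((-η : ℝ) : ℂ) + y * I) + 1) + 1 / ((((-η : ℝ) : ℂ) + y * I) + 2)) := by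
    unfold mellinInv
    rw [Complex.real_smul]
    congr 1
    refine integral_congr_ae (Eventually.of_forall fun y ↦ ?_)
    simp only
    rw [ofReal_one, one_cpow, one_smul]
    exact (hasMellin_kfun_sub_one (z := ((-η : ℝ) : ℂ) + y * I) (by simp; linarith)
      (by simp; linarith)).2
  rw [e] at h'
  have h3 : ∫ y : ℝ, ((1 : ℂ) / (((-η : ℝ) : ℂ) + y * I) - 2 / ((((-η : ℝ) : ℂ) + y * I) + 1) + 1 / ((((-η : ℝ) : ℂ) + y * I) + 2)) =
      ((2 * π : ℝ) : ℂ) * (((1 / (2 * π) : ℝ) : ℂ) * ∫ y : ℝ, ((1 : ℂ) / (((-η : ℝ) : ℂ) + y * I) - 2 / ((((-η : ℝ) : ℂ) + y * I) + 1) + 1 / ((((-η : ℝ) : ℂ) + y * I) + 2))) := by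
    rw [← mul_assoc, ← ofReal_mul, show (2 * π) * (1 / (2 * π)) = (1 : ℝ) by field_simp,
      ofReal_one, one_mul]
  rw [h3, h']
  push_cast
  ring

/-- **`∫ K(c+iy) dy = 0`** for `c > 0` (Mellin inversion for `k` at `x = 1`, where `k(1) = 0`).
[folklore] -/
theorem integral_Kfun_line_pos {c : ℝ} (hc : 0 < c) :
    ∫ y : ℝ, ((1 : ℂ) / ((c : ℂ) + y * I) - 2 / (((c : ℂ) + y * I) + 1) + 1 / (((c : ℂ) + y * I) + 2)) = 0 := by
  have h := kfun_eq_integral hc zero_lt_one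
  simp only [sub_self, max_self, ne_eq, OfNat.ofNat_ne_zero, not_false_eq_true, zero_pow,
    ofReal_zero, ofReal_one, one_cpow, one_mul] at h
  have hπ : ((1 / (2 * π) : ℝ) : ℂ) ≠ 0 := by
    exact_mod_cast (by positivity : (0 : ℝ) < 1 / (2 * π)).ne'
  exact (mul_eq_zero.mp h.symm).resolve_left hπ

/-! ### Shifting the Perron integral past the pole of `K` at `z = 0` (under RH) -/

open MertensBoundRH in
/-- **Contour shift for the Riesz–Perron integral under RH.** Let `0 < η < 1`, `c > 0`, `n ≥ 1`,
and `w` with `Re w - η > 1/2`. Then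
`∫ n^{c+iy} K(c+iy) ζinv(w+c+iy) dy = 2π ζinv(w) + ∫ n^{-η+iy} K(-η+iy) ζinv(w-η+iy) dy`,
where `ζinv` is `1/ζ` with the removable singularity at `1` filled in (holomorphic on `Re s > 1/2`
under RH, `MertensBoundRH.zetaInv`). Proof: Cauchy's theorem for the pole-free function
`H(z) = (2/((z+1)(z+2))) · (f(z) - f(0))/z`, `f(z) = n^z ζinv(w+z)`, between the lines `Re z = -η`
and `Re z = c` (`MertensBoundRH.integral_vertical_eq_of_tendsto`; the horizontal decay comes from
`K(z) = O(|Im z|^{-3})` and Littlewood's `ζinv = O((1+|t|)^{1/2})`), together with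
`∫ K(c+iy)dy = 0` and `∫ K(-η+iy)dy = -2π`. [cite: Titchmarsh1986, §3.12 and §14.25 (moving the
line of integration past `Re w = 1` under RH)] -/
theorem perronIntegral_shift (hRH : RiemannHypothesis) {η c : ℝ} (hη0 : 0 < η) (hη1 : η < 1)
    (hc : 0 < c) {w : ℂ} (hw : 1 / 2 < w.re - η) {n : ℕ} (hn : 0 < n) :
    ∫ y : ℝ, (n : ℂ) ^ ((c : ℂ) + y * I) * ((1 : ℂ) / ((c : ℂ) + y * I) - 2 / (((c : ℂ) + y * I) + 1) + 1 / (((c : ℂ) + y * I) + 2)) * zetaInv (w + c + y * I) =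
      2 * π * zetaInv w +
      ∫ y : ℝ, (n : ℂ) ^ (((-η : ℝ) : ℂ) + y * I) * ((1 : ℂ) / (((-η : ℝ) : ℂ) + y * I) - 2 / ((((-η : ℝ) : ℂ) + y * I) + 1) + 1 / ((((-η : ℝ) : ℂ) + y * I) + 2)) *
        zetaInv (w + ((-η : ℝ) : ℂ) + y * I) := by
  have hn' : (0 : ℝ) < n := by exact_mod_cast hn
  have hnC : (n : ℂ) ≠ 0 := by exact_mod_cast hn.ne'
  -- the functions
  set f : ℂ → ℂ := fun z ↦ (n : ℂ) ^ z * zetaInv (w + z) with hf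
  set H : ℂ → ℂ := fun z ↦ 2 / ((z + 1) * (z + 2)) * dslope f 0 z with hH
  have hf0 : f 0 = zetaInv w := by simp [hf]
  -- differentiability
  set U : Set ℂ := {z : ℂ | 1 / 2 - w.re < z.re ∧ -1 < z.re} with hU
  have hUo : IsOpen U :=
    (isOpen_lt continuous_const continuous_re).inter (isOpen_lt continuous_const continuous_re)
  have hU0 : U ∈ 𝓝 (0 : ℂ) := hUo.mem_nhds ⟨by simp; linarith, by simp⟩
  have hfd : DifferentiableOn ℂ f U := by
    intro z hz
    refine DifferentiableAt.differentiableWithinAt ?_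
    refine DifferentiableAt.mul ?_ ?_
    · exact differentiableAt_id.const_cpow (Or.inl hnC)
    · have hwz : 1 / 2 < (w + z).re := by simp; linarith [hz.1]
      have hopen : IsOpen {s : ℂ | 1 / 2 < s.re} := isOpen_lt continuous_const continuous_re
      exact ((differentiableOn_zetaInv hRH).differentiableAt (hopen.mem_nhds hwz)).comp z
        (differentiableAt_id.const_add w)
  have hHd : DifferentiableOn ℂ H U := by
    refine DifferentiableOn.mul ?_ ((Complex.differentiableOn_dslope hU0).mpr hfd)
    intro z hz
    have h1 : z + 1 ≠ 0 := by
      intro h; have := congrArg re h; simp at this; linarith [hz.2]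
    have h2 : z + 2 ≠ 0 := by
      intro h; have := congrArg re h; simp at this; linarith [hz.2]
    refine DifferentiableAt.differentiableWithinAt ?_
    refine DifferentiableAt.div (differentiableAt_const _) (by fun_prop) (mul_ne_zero h1 h2)
  have hstrip : Icc (-η) c ×ℂ univ ⊆ U := by
    intro z hz
    rw [mem_reProdIm] at hz
    exact ⟨by linarith [hz.1.1], by linarith [hz.1.1]⟩
  -- `H = K · (f - f 0)` off `z = 0`
  have hHK : ∀ z : ℂ, z ≠ 0 → z + 1 ≠ 0 → z + 2 ≠ 0 → H z = ((1 : ℂ) / z - 2 / (z + 1) + 1 / (z + 2)) * (f z - f 0) := by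
    intro z h0 h1 h2
    simp only [hH]
    rw [dslope_of_ne _ h0, slope_def_module, sub_zero, Kfun_eq h0 h1 h2, smul_eq_mul]
    field_simp
  -- points on the two lines are `≠ 0, -1, -2`
  have hline_ne : ∀ σ : ℝ, σ ≠ 0 → -1 < σ → ∀ y : ℝ,
      ((σ : ℂ) + y * I ≠ 0) ∧ ((σ : ℂ) + y * I + 1 ≠ 0) ∧ ((σ : ℂ) + y * I + 2 ≠ 0) := by
    intro σ hσ hσ1 y
    refine ⟨?_, ?_, ?_⟩ <;> intro h <;> have := congrArg re h <;> simp at this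
    · exact hσ this
    · linarith
    · linarith
  -- the Littlewood bound for `ζinv`
  obtain ⟨Kz, hKz, hKzb⟩ := exists_bound_zetaInv hRH hw (show (0 : ℝ) < 1 / 2 by norm_num)
  have hfb : ∀ σ y : ℝ, -η ≤ σ → σ ≤ c →
      ‖f ((σ : ℂ) + y * I)‖ ≤ (n : ℝ) ^ c * (Kz * (1 + |w.im|) ^ (1 / 2 : ℝ)) *
        (1 + |y|) ^ (1 / 2 : ℝ) := by
    intro σ y hσ1 hσ2
    simp only [hf, norm_mul]
    have e1 : ‖(n : ℂ) ^ ((σ : ℂ) + y * I)‖ = (n : ℝ) ^ σ := by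
      rw [show ((n : ℂ)) = ((n : ℝ) : ℂ) by norm_cast, Complex.norm_cpow_eq_rpow_re_of_pos hn']
      simp
    have e2 : w + ((σ : ℂ) + y * I) = ((w.re + σ : ℝ) : ℂ) + ((w.im + y : ℝ) : ℂ) * I := by
      apply Complex.ext <;> simp
    rw [e1, e2]
    have hb := hKzb (w.re + σ) (w.im + y) (by linarith)
    have hnσ : (n : ℝ) ^ σ ≤ (n : ℝ) ^ c :=
      Real.rpow_le_rpow_of_exponent_le (by exact_mod_cast hn) hσ2
    have hsplit : (1 + |w.im + y|) ^ (1 / 2 : ℝ) ≤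
        (1 + |w.im|) ^ (1 / 2 : ℝ) * (1 + |y|) ^ (1 / 2 : ℝ) := by
      rw [← Real.mul_rpow (by positivity) (by positivity)]
      refine Real.rpow_le_rpow (by positivity) ?_ (by norm_num)
      have := abs_add_le w.im y
      nlinarith [abs_nonneg w.im, abs_nonneg y]
    have h0 : 0 ≤ (n : ℝ) ^ σ := Real.rpow_nonneg hn'.le _
    calc (n : ℝ) ^ σ * ‖zetaInv (↑(w.re + σ) + ↑(w.im + y) * I)‖
        ≤ (n : ℝ) ^ c * (Kz * (1 + |w.im + y|) ^ (1 / 2 : ℝ)) := by gcongr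
      _ ≤ (n : ℝ) ^ c * (Kz * ((1 + |w.im|) ^ (1 / 2 : ℝ) * (1 + |y|) ^ (1 / 2 : ℝ))) := by gcongr
      _ = (n : ℝ) ^ c * (Kz * (1 + |w.im|) ^ (1 / 2 : ℝ)) * (1 + |y|) ^ (1 / 2 : ℝ) := by ring
  set A : ℝ := (n : ℝ) ^ c * (Kz * (1 + |w.im|) ^ (1 / 2 : ℝ)) with hA
  have hA0 : 0 ≤ A := by positivity
  -- continuity of `H` on the lines
  have hHcont : ∀ σ : ℝ, -η ≤ σ → σ ≤ c → Continuous fun y : ℝ ↦ H ((σ : ℂ) + y * I) := by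
    intro σ hσ1 hσ2
    refine (hHd.continuousOn.comp_continuous (by fun_prop) fun y ↦ hstrip ?_)
    rw [mem_reProdIm]; exact ⟨⟨by simpa using hσ1, by simpa using hσ2⟩, mem_univ _⟩
  -- integrability of `H` on the two lines
  have hHint : ∀ σ : ℝ, σ ≠ 0 → -η ≤ σ → σ ≤ c → ∀ {m : ℝ}, 0 < m → m ≤ |σ| → m ≤ |σ + 1| →
      m ≤ |σ + 2| → Integrable fun y : ℝ ↦ H ((σ : ℂ) + y * I) := by
    intro σ hσ hσ1 hσ2 m hm h0 h1 h2
    have hK := integrable_Kfun_line_rpow hm h0 h1 h2 (show (1 / 2 : ℝ) < 1 by norm_num)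
    refine (hK.const_mul (A + ‖f 0‖)).mono' (hHcont σ hσ1 hσ2).aestronglyMeasurable
      (Eventually.of_forall fun y ↦ ?_)
    obtain ⟨hz0, hz1, hz2⟩ := hline_ne σ hσ (by linarith) y
    rw [hHK _ hz0 hz1 hz2, norm_mul]
    have hy1 : 1 ≤ (1 + |y|) ^ (1 / 2 : ℝ) := Real.one_le_rpow (by linarith [abs_nonneg y]) (by norm_num)
    have hK0 : 0 ≤ ‖((1 : ℂ) / ((σ : ℂ) + y * I) - 2 / (((σ : ℂ) + y * I) + 1) + 1 / (((σ : ℂ) + y * I) + 2))‖ := norm_nonneg _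
    calc ‖((1 : ℂ) / ((σ : ℂ) + y * I) - 2 / (((σ : ℂ) + y * I) + 1) + 1 / (((σ : ℂ) + y * I) + 2))‖ * ‖f ((σ : ℂ) + y * I) - f 0‖
        ≤ ‖((1 : ℂ) / ((σ : ℂ) + y * I) - 2 / (((σ : ℂ) + y * I) + 1) + 1 / (((σ : ℂ) + y * I) + 2))‖ * (‖f ((σ : ℂ) + y * I)‖ + ‖f 0‖) := by
          gcongr; exact norm_sub_le _ _
      _ ≤ ‖((1 : ℂ) / ((σ : ℂ) + y * I) - 2 / (((σ : ℂ) + y * I) + 1) + 1 / (((σ : ℂ) + y * I) + 2))‖ * (A * (1 + |y|) ^ (1 / 2 : ℝ) + ‖f 0‖ * (1 + |y|) ^ (1 / 2 : ℝ)) := by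
          gcongr
          · exact hfb σ y hσ1 hσ2
          · nlinarith [norm_nonneg (f 0)]
      _ = (A + ‖f 0‖) * (‖((1 : ℂ) / ((σ : ℂ) + y * I) - 2 / (((σ : ℂ) + y * I) + 1) + 1 / (((σ : ℂ) + y * I) + 2))‖ * (1 + |y|) ^ (1 / 2 : ℝ)) := by ring
  have hHa : Integrable fun y : ℝ ↦ H ((((-η : ℝ)) : ℂ) + y * I) := by
    refine hHint (-η) (by linarith) le_rfl (by linarith) (m := min η (1 - η))
      (lt_min hη0 (by linarith)) ?_ ?_ ?_
    · rw [abs_of_neg (by linarith)]; simp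
    · rw [abs_of_pos (by linarith)]; exact (min_le_right _ _).trans (by linarith)
    · rw [abs_of_pos (by linarith)]; exact (min_le_right _ _).trans (by linarith)
  have hHb : Integrable fun y : ℝ ↦ H ((c : ℂ) + y * I) := by
    refine hHint c hc.ne' (by linarith) le_rfl (m := c) hc ?_ ?_ ?_
    · rw [abs_of_pos hc]
    · rw [abs_of_pos (by linarith)]; linarith
    · rw [abs_of_pos (by linarith)]; linarith
  -- horizontal decay
  have hdecay : ∀ ε : ℝ, 0 < ε → ∃ T₀ : ℝ, ∀ σ ∈ Icc (-η) c, ∀ T : ℝ, T₀ ≤ |T| →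
      ‖H ((σ : ℂ) + T * I)‖ ≤ ε := by
    intro ε hε
    refine ⟨max 1 (2 * (2 * A + ‖f 0‖) / ε), fun σ hσ T hT ↦ ?_⟩
    have hT1 : 1 ≤ |T| := le_trans (le_max_left _ _) hT
    have hT2 : 2 * (2 * A + ‖f 0‖) / ε ≤ |T| := le_trans (le_max_right _ _) hT
    have hTpos : 0 < |T| := by linarith
    set z : ℂ := (σ : ℂ) + T * I with hz
    have hzj : ∀ j : ℝ, |T| ≤ ‖z + j‖ := by
      intro j
      have := abs_im_le_norm (z + j)
      simpa [hz] using this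
    have hz0 : z ≠ 0 := by
      have := hzj 0; simp at this; exact norm_pos_iff.mp (by linarith)
    have hz1 : z + 1 ≠ 0 := norm_pos_iff.mp (by have := hzj 1; push_cast at this; linarith)
    have hz2 : z + 2 ≠ 0 := norm_pos_iff.mp (by have := hzj 2; push_cast at this; linarith)
    -- `‖K z‖ ≤ 2/|T|³`
    have hKz : ‖((1 : ℂ) / z - 2 / (z + 1) + 1 / (z + 2))‖ ≤ 2 / |T| ^ 3 := by
      rw [Kfun_eq hz0 hz1 hz2, norm_div, Complex.norm_ofNat, norm_mul, norm_mul]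
      rw [div_le_div_iff₀ (by positivity) (by positivity)]
      have h0' := hzj 0; simp only [ofReal_zero, add_zero] at h0'
      have h1' := hzj 1; push_cast at h1'
      have h2' := hzj 2; push_cast at h2'
      have : |T| ^ 3 ≤ ‖z‖ * ‖z + 1‖ * ‖z + 2‖ := by
        calc |T| ^ 3 = |T| * |T| * |T| := by ring
          _ ≤ ‖z‖ * ‖z + 1‖ * ‖z + 2‖ := by
            apply mul_le_mul (mul_le_mul h0' h1' hTpos.le (norm_nonneg _)) h2' hTpos.le
              (by positivity)
      linarith
    have hfz : ‖f z‖ ≤ A * (1 + |T|) ^ (1 / 2 : ℝ) := hfb σ T hσ.1 hσ.2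
    have hsq : (1 + |T|) ^ (1 / 2 : ℝ) ≤ 2 * |T| := by
      have h1 : (1 + |T|) ^ (1 / 2 : ℝ) ≤ (1 + |T|) ^ (1 : ℝ) :=
        Real.rpow_le_rpow_of_exponent_le (by linarith) (by norm_num)
      rw [Real.rpow_one] at h1
      linarith
    rw [hHK z hz0 hz1 hz2, norm_mul]
    calc ‖((1 : ℂ) / z - 2 / (z + 1) + 1 / (z + 2))‖ * ‖f z - f 0‖ ≤ (2 / |T| ^ 3) * (A * (2 * |T|) + ‖f 0‖ * |T|) := by
          refine mul_le_mul hKz ?_ (norm_nonneg _) (by positivity)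
          calc ‖f z - f 0‖ ≤ ‖f z‖ + ‖f 0‖ := norm_sub_le _ _
            _ ≤ A * (1 + |T|) ^ (1 / 2 : ℝ) + ‖f 0‖ * 1 := by rw [mul_one]; gcongr
            _ ≤ A * (2 * |T|) + ‖f 0‖ * |T| := by gcongr
      _ = 2 * (2 * A + ‖f 0‖) / |T| ^ 2 := by field_simp
      _ ≤ 2 * (2 * A + ‖f 0‖) / |T| := by
          refine div_le_div_of_nonneg_left (by positivity) hTpos ?_
          nlinarith
      _ ≤ ε := by
          rw [div_le_iff₀ hTpos]
          have := (div_le_iff₀ hε).mp hT2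
          linarith
  -- Cauchy: the two line integrals of `H` agree
  have hshift := integral_vertical_eq_of_tendsto H (by linarith : -η ≤ c) (hHd.mono hstrip)
    hHa hHb hdecay
  -- expand `H = K f - f(0) K` on both lines
  have hKa := integrable_Kfun_line (σ := -η) (m := min η (1 - η)) (lt_min hη0 (by linarith))
    (by rw [abs_of_neg (by linarith)]; simp)
    (by rw [abs_of_pos (by linarith)]; exact (min_le_right _ _).trans (by linarith))
    (by rw [abs_of_pos (by linarith)]; exact (min_le_right _ _).trans (by linarith))
  have hKb := integrable_Kfun_line (σ := c) (m := c) hc (by rw [abs_of_pos hc])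
    (by rw [abs_of_pos (by linarith)]; linarith) (by rw [abs_of_pos (by linarith)]; linarith)
  have hexpand : ∀ σ : ℝ, σ ≠ 0 → -1 < σ → Integrable (fun y : ℝ ↦ H ((σ : ℂ) + y * I)) →
      Integrable (fun y : ℝ ↦ ((1 : ℂ) / ((σ : ℂ) + y * I) - 2 / (((σ : ℂ) + y * I) + 1) + 1 / (((σ : ℂ) + y * I) + 2))) →
      ∫ y : ℝ, H ((σ : ℂ) + y * I) =
        (∫ y : ℝ, (n : ℂ) ^ ((σ : ℂ) + y * I) * ((1 : ℂ) / ((σ : ℂ) + y * I) - 2 / (((σ : ℂ) + y * I) + 1) + 1 / (((σ : ℂ) + y * I) + 2)) *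
          zetaInv (w + σ + y * I)) - f 0 * ∫ y : ℝ, ((1 : ℂ) / ((σ : ℂ) + y * I) - 2 / (((σ : ℂ) + y * I) + 1) + 1 / (((σ : ℂ) + y * I) + 2)) := by
    intro σ hσ hσ1 hHi hKi
    have hptw : ∀ y : ℝ, H ((σ : ℂ) + y * I) =
        (n : ℂ) ^ ((σ : ℂ) + y * I) * ((1 : ℂ) / ((σ : ℂ) + y * I) - 2 / (((σ : ℂ) + y * I) + 1) + 1 / (((σ : ℂ) + y * I) + 2)) * zetaInv (w + σ + y * I) -
          f 0 * ((1 : ℂ) / ((σ : ℂ) + y * I) - 2 / (((σ : ℂ) + y * I) + 1) + 1 / (((σ : ℂ) + y * I) + 2)) := by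
      intro y
      obtain ⟨hz0, hz1, hz2⟩ := hline_ne σ hσ hσ1 y
      rw [hHK _ hz0 hz1 hz2]
      simp only [hf]
      ring_nf
    have hKfi : Integrable fun y : ℝ ↦ f 0 * ((1 : ℂ) / ((σ : ℂ) + y * I) - 2 / (((σ : ℂ) + y * I) + 1) + 1 / (((σ : ℂ) + y * I) + 2)) := hKi.const_mul _
    have hmain : Integrable fun y : ℝ ↦
        (n : ℂ) ^ ((σ : ℂ) + y * I) * ((1 : ℂ) / ((σ : ℂ) + y * I) - 2 / (((σ : ℂ) + y * I) + 1) + 1 / (((σ : ℂ) + y * I) + 2)) * zetaInv (w + σ + y * I) := by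
      have := hHi.add hKfi
      refine this.congr (Eventually.of_forall fun y ↦ ?_)
      simp only [Pi.add_apply, hptw]
      ring
    simp_rw [hptw]
    rw [integral_sub hmain hKfi, integral_const_mul]
  have ha := hexpand (-η) (by linarith) (by linarith) (by simpa using hHa) (by simpa using hKa)
  have hb := hexpand c hc.ne' (by linarith) hHb hKb
  rw [integral_Kfun_line_pos hc, mul_zero, sub_zero] at hb
  have hKneg := integral_Kfun_line_neg hη0 hη1
  push_cast at ha hb hshift hKneg ⊢
  rw [hKneg] at ha
  rw [ha, hb, hf0] at hshift
  -- `hshift : (∫ ... (-η) ...) - ζinv w * (-(2π)) = ∫ ... c ...`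
  rw [← hshift]
  ring

/-! ### The Riesz means approximate `1/ζ` on `Re w = 1/2 + δ` under RH -/

open MertensBoundRH in
/-- **Riesz means of `μ(a)a^{-w}` under RH** (the Riesz-mean form of Titchmarsh Thm. 14.25 (A) /
Báez-Duarte's use of Balazard–Saias, *Notes 1*, Lemme 2): assume RH and let `0 < δ < 1/2`,
`0 < ε ≤ 1/2`. There is `C` such that for all `n ≥ 1` and real `t`, with `w = 1/2 + δ + it`,
`|Σ_{a ≤ n} μ(a)(1 - a/n)² a^{-w} - 1/ζ(w)| ≤ C n^{-δ/2} (1+|t|)^ε`.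
Proof: Perron's formula for the Riesz means (`rieszSum_eq_integral`, line `Re z = 1`), the contour
shift to `Re z = -δ/2` past the pole of the kernel at `z = 0` with residue `1/ζ(w)`
(`perronIntegral_shift`), and Littlewood's `1/ζ(σ+it) = O((1+|t|)^ε)` on `σ ≥ 1/2 + δ/2`
(`MertensBoundRH.exists_bound_zetaInv`, Titchmarsh (14.2.6)) on the new line, where
`|n^z| = n^{-δ/2}` and `∫ |K(-δ/2+iy)| (1+|y|)^ε dy < ∞`.
[cite: Titchmarsh1986, Thm 14.25 (A) and §14.25 (proof of (C)); BaezDuarte2003, Lemma 2.1] -/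
theorem norm_rieszSum_sub_inv_riemannZeta_le (hRH : RiemannHypothesis) {δ : ℝ} (hδ0 : 0 < δ)
    (hδ : δ < 1 / 2) {ε : ℝ} (hε0 : 0 < ε) (hε : ε ≤ 1 / 2) :
    ∃ C : ℝ, 0 < C ∧ ∀ n : ℕ, 0 < n → ∀ t : ℝ,
      ‖(∑ a ∈ Finset.range n, ((ArithmeticFunction.moebius (a + 1) : ℤ) : ℂ) *
          ((((1 : ℝ) - ((a : ℝ) + 1) / n) ^ 2 : ℝ) : ℂ) *
          ((a : ℂ) + 1) ^ (-((((1 / 2 + δ : ℝ)) : ℂ) + t * I))) -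
        (riemannZeta ((((1 / 2 + δ : ℝ)) : ℂ) + t * I))⁻¹‖ ≤
        C * (n : ℝ) ^ (-(δ / 2)) * (1 + |t|) ^ ε := by
  obtain ⟨Kz, hKz, hKzb⟩ := exists_bound_zetaInv hRH (σ₀ := 1 / 2 + δ / 2) (by linarith) hε0
  -- the weighted integral of the kernel on `Re z = -δ/2`
  have hm : 0 < δ / 2 := by linarith
  have h0 : δ / 2 ≤ |(-(δ / 2) : ℝ)| := by rw [abs_of_neg (by linarith)]; linarith
  have h1 : δ / 2 ≤ |(-(δ / 2) : ℝ) + 1| := by rw [abs_of_pos (by linarith)]; linarith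
  have h2 : δ / 2 ≤ |(-(δ / 2) : ℝ) + 2| := by rw [abs_of_pos (by linarith)]; linarith
  have hKI := integrable_Kfun_line_rpow hm h0 h1 h2 (show ε < 1 by linarith)
  set IK : ℝ := ∫ y : ℝ, ‖((1 : ℂ) / ((((-(δ / 2)) : ℝ) : ℂ) + y * I) - 2 / (((((-(δ / 2)) : ℝ) : ℂ) + y * I) + 1) + 1 / (((((-(δ / 2)) : ℝ) : ℂ) + y * I) + 2))‖ * (1 + |y|) ^ ε with hIK
  have hIK0 : 0 ≤ IK := integral_nonneg fun y ↦ by positivity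
  refine ⟨1 / (2 * π) * Kz * IK + 1, by positivity, fun n hn t ↦ ?_⟩
  have hn' : (0 : ℝ) < n := by exact_mod_cast hn
  set w : ℂ := (((1 / 2 + δ : ℝ)) : ℂ) + t * I with hw
  have hwre : w.re = 1 / 2 + δ := by simp [hw]
  have hwim : w.im = t := by simp [hw]
  have hw1 : w ≠ 1 := by
    intro h; have := congrArg re h; rw [hwre] at this; simp at this; linarith
  -- Perron on `Re z = 1`
  have hP := rieszSum_eq_integral (c := 1) one_pos (w := w) (by rw [hwre]; linarith) hn
  have hζinv : ∀ y : ℝ, (riemannZeta (w + (1 : ℝ) + y * I))⁻¹ = zetaInv (w + (1 : ℝ) + y * I) := by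
    intro y
    refine (zetaInv_of_ne_one ?_).symm
    intro h; have := congrArg re h; simp [hwre] at this; linarith
  have hP' : ∫ y : ℝ, (n : ℂ) ^ (((1 : ℝ) : ℂ) + y * I) * ((1 : ℂ) / (((1 : ℝ) : ℂ) + y * I) - 2 / ((((1 : ℝ) : ℂ) + y * I) + 1) + 1 / ((((1 : ℝ) : ℂ) + y * I) + 2)) *
      (riemannZeta (w + (1 : ℝ) + y * I))⁻¹ =
      ∫ y : ℝ, (n : ℂ) ^ (((1 : ℝ) : ℂ) + y * I) * ((1 : ℂ) / (((1 : ℝ) : ℂ) + y * I) - 2 / ((((1 : ℝ) : ℂ) + y * I) + 1) + 1 / ((((1 : ℝ) : ℂ) + y * I) + 2)) *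
      zetaInv (w + (1 : ℝ) + y * I) :=
    integral_congr_ae (Eventually.of_forall fun y ↦ by simp only [hζinv])
  -- shift to `Re z = -δ/2`
  have hS := perronIntegral_shift hRH (η := δ / 2) (c := 1) hm (by linarith) one_pos (w := w)
    (by rw [hwre]; linarith) hn
  -- the error integral
  set E : ℂ := ∫ y : ℝ, (n : ℂ) ^ ((((-(δ / 2)) : ℝ) : ℂ) + y * I) *
    ((1 : ℂ) / ((((-(δ / 2)) : ℝ) : ℂ) + y * I) - 2 / (((((-(δ / 2)) : ℝ) : ℂ) + y * I) + 1) + 1 / (((((-(δ / 2)) : ℝ) : ℂ) + y * I) + 2)) * zetaInv (w + (((-(δ / 2)) : ℝ) : ℂ) + y * I) with hE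
  have hmain : (∑ a ∈ Finset.range n, ((ArithmeticFunction.moebius (a + 1) : ℤ) : ℂ) *
          ((((1 : ℝ) - ((a : ℝ) + 1) / n) ^ 2 : ℝ) : ℂ) * ((a : ℂ) + 1) ^ (-w)) -
        (riemannZeta w)⁻¹ = ((1 / (2 * π) : ℝ) : ℂ) * E := by
    rw [hP, hP', hS, ← zetaInv_of_ne_one hw1, mul_add]
    have : ((1 / (2 * π) : ℝ) : ℂ) * (2 * π * zetaInv w) = zetaInv w := by
      rw [← mul_assoc, show ((1 / (2 * π) : ℝ) : ℂ) * (2 * π) = 1 by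
        push_cast; field_simp, one_mul]
    rw [this]
    ring
  -- bound the error integral
  have hEle : ‖E‖ ≤ (n : ℝ) ^ (-(δ / 2)) * (Kz * (1 + |t|) ^ ε) * IK := by
    rw [hIK, ← integral_const_mul]
    refine norm_integral_le_of_norm_le (hKI.const_mul _) (Eventually.of_forall fun y ↦ ?_)
    rw [norm_mul, norm_mul]
    have e1 : ‖(n : ℂ) ^ ((((-(δ / 2)) : ℝ) : ℂ) + y * I)‖ = (n : ℝ) ^ (-(δ / 2)) := by
      rw [show ((n : ℂ)) = ((n : ℝ) : ℂ) by norm_cast, Complex.norm_cpow_eq_rpow_re_of_pos hn']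
      simp
    have e2 : w + (((-(δ / 2)) : ℝ) : ℂ) + y * I =
        (((1 / 2 + δ / 2 : ℝ)) : ℂ) + (((t + y : ℝ)) : ℂ) * I := by
      rw [hw]; push_cast; ring
    rw [e1, e2]
    have hz := hKzb (1 / 2 + δ / 2) (t + y) le_rfl
    have hsplit : (1 + |t + y|) ^ ε ≤ (1 + |t|) ^ ε * (1 + |y|) ^ ε := by
      rw [← Real.mul_rpow (by positivity) (by positivity)]
      refine Real.rpow_le_rpow (by positivity) ?_ hε0.le
      have := abs_add_le t y
      nlinarith [abs_nonneg t, abs_nonneg y]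
    have hK0 : 0 ≤ ‖((1 : ℂ) / ((((-(δ / 2)) : ℝ) : ℂ) + y * I) - 2 / (((((-(δ / 2)) : ℝ) : ℂ) + y * I) + 1) + 1 / (((((-(δ / 2)) : ℝ) : ℂ) + y * I) + 2))‖ := norm_nonneg _
    have hnpos : 0 ≤ (n : ℝ) ^ (-(δ / 2)) := Real.rpow_nonneg hn'.le _
    calc (n : ℝ) ^ (-(δ / 2)) * ‖((1 : ℂ) / ((((-(δ / 2)) : ℝ) : ℂ) + y * I) - 2 / (((((-(δ / 2)) : ℝ) : ℂ) + y * I) + 1) + 1 / (((((-(δ / 2)) : ℝ) : ℂ) + y * I) + 2))‖ *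
          ‖zetaInv ((((1 / 2 + δ / 2 : ℝ)) : ℂ) + (((t + y : ℝ)) : ℂ) * I)‖
        ≤ (n : ℝ) ^ (-(δ / 2)) * ‖((1 : ℂ) / ((((-(δ / 2)) : ℝ) : ℂ) + y * I) - 2 / (((((-(δ / 2)) : ℝ) : ℂ) + y * I) + 1) + 1 / (((((-(δ / 2)) : ℝ) : ℂ) + y * I) + 2))‖ *
          (Kz * ((1 + |t|) ^ ε * (1 + |y|) ^ ε)) := by
          gcongr
          exact hz.trans (by gcongr)
      _ = (n : ℝ) ^ (-(δ / 2)) * (Kz * (1 + |t|) ^ ε) *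
          (‖((1 : ℂ) / ((((-(δ / 2)) : ℝ) : ℂ) + y * I) - 2 / (((((-(δ / 2)) : ℝ) : ℂ) + y * I) + 1) + 1 / (((((-(δ / 2)) : ℝ) : ℂ) + y * I) + 2))‖ * (1 + |y|) ^ ε) := by ring
  -- conclude
  have hw' : -((((1 / 2 + δ : ℝ)) : ℂ) + t * I) = -w := by rw [hw]
  rw [hw', hmain, norm_mul, Complex.norm_real, Real.norm_eq_abs,
    abs_of_pos (by positivity : (0 : ℝ) < 1 / (2 * π))]
  have hX : 0 ≤ (n : ℝ) ^ (-(δ / 2)) * (1 + |t|) ^ ε := by positivity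
  calc 1 / (2 * π) * ‖E‖ ≤ 1 / (2 * π) * ((n : ℝ) ^ (-(δ / 2)) * (Kz * (1 + |t|) ^ ε) * IK) := by
        gcongr
    _ = (1 / (2 * π) * Kz * IK) * ((n : ℝ) ^ (-(δ / 2)) * (1 + |t|) ^ ε) := by ring
    _ ≤ (1 / (2 * π) * Kz * IK + 1) * ((n : ℝ) ^ (-(δ / 2)) * (1 + |t|) ^ ε) := by
        gcongr; linarith
    _ = (1 / (2 * π) * Kz * IK + 1) * (n : ℝ) ^ (-(δ / 2)) * (1 + |t|) ^ ε := by ring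

end RieszPerron

end Literature.NumberTheory.LFunctions

end
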